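import Literature.Analysis.FluidPDE.TorusPressurePoisson
import Literature.Analysis.FunctionSpaces.TorusAxisAverageCalculus
import HarnessLib

/-!
# The potential `Δ⁻¹ div F` of an `L^p` vector field on the flat torus (the force half of the pressure)

Analysis/FluidPDE support file (everything PROVED) on the decomposition path of the named fact
`Torus.exists_pressure_of_isWeakNSSolutionForcedOn` (`FluidPDE/WeakSolution`; recovery of the
pressure of a *forced* weak solution of Navier–Stokes on `T^d`, Robinson–Rodrigo–Sadowski 2016,
Lemma 5.1 and Prop. 5.3; Temam 1984, Ch. I Prop. 1.1–1.2 and Ch. III §1.5). For a forced weak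
solution the pressure is `p = (−Δ)⁻¹ div div (u ⊗ u) − (−Δ)⁻¹ div f`; the tensor half
`(−Δ)⁻¹ div div (u ⊗ u)` is the tree's `Torus.exists_pressure` (`FluidPDE/TorusPressurePoisson`,
modulo the Calderón–Zygmund hypothesis `Torus.HessianBound d p C`). This file supplies the
**force half**: given a vector field `F = (Fⱼ(a, x))` on a parameter space times the torus with
`Fⱼ ∈ L^p(α × T^d)`, a jointly measurable `R : α → T^d → ℝ` with
`∫⁻ |R|^r ≤ K' ∑ⱼ ∫⁻ |Fⱼ|^r` (`r = p.toReal`) whose slices solve `ΔR(a) = div F(a)` very weakly for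
a.e. `a`: `∫ R(a) Δφ = -∑ⱼ ∫ Fⱼ(a) ∂ⱼφ` for every `φ ∈ C^∞(T^d)` (`Torus.exists_forcePotential`),
under the same hypothesis `Torus.HessianBound d p C` and by the same scheme as the tensor half.

## The gradient bound from the Hessian bound (no new singular integrals)

The `L^p` input needed for the order `-1` operator `∂ⱼΔ⁻¹` is `‖∂ⱼw‖_p ≤ C'‖Δw‖_p` for smooth `w`.
It follows from the Hessian bound with the **same constant**, by a Poincaré inequality along one
coordinate circle: the restriction `γ(s) = ∂ⱼw(x + s eⱼ)` of `∂ⱼw` to the `j`-th circle through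
`x` has zero mean over a period (it is the derivative of the periodic `s ↦ w(x + s eⱼ)`), and
`γ(s) - γ(0) = ∫₀ˢ ∂ⱼ∂ⱼw(x + σ eⱼ) dσ`, whence `|∂ⱼw(x)| = |∫₀¹ (γ(0) - γ(s)) ds| ≤ ∫₀¹ |∂ⱼ∂ⱼw(x + σeⱼ)| dσ`,
the average of `|∂ⱼ∂ⱼw|` over the circle (`Torus.norm_partialDeriv_le_axisAvg`, with the tree's
`Torus.axisAvg` and `Torus.hasDerivAt_comp_add_proj_smul`). Axis averages do not increase `L^p`
norms (Minkowski's integral inequality and translation invariance,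
`Torus.eLpNorm_axisAvg_le_of_exponent`), so `‖∂ⱼw‖_p ≤ ‖∂ⱼ∂ⱼw‖_p ≤ C‖Δw‖_p`
(`Torus.eLpNorm_partialDeriv_le_partialDeriv_partialDeriv`, `Torus.eLpNorm_partialDeriv_le_of_hessianBound`).

## Construction of the potential (mirror of `TorusPressurePoisson`)

For a smooth kernel `ρ` put `λⱼ[ρ] := ∂ⱼΔ⁻¹ρ` and, for a vector slice
`g = (gⱼ)`, `gⱼ ∈ L¹(T^d)`, `r_ρ[g] := ∑ⱼ gⱼ ⋆ λⱼ[ρ] = ∑ⱼ ∂ⱼ(gⱼ ⋆ Δ⁻¹ρ)` (notation only: no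
definitions are introduced, the sums are written out in every statement).
Slice facts: `∫ r_ρ[g] Δφ = -∑ⱼ ∫ (gⱼ ⋆ ρ) ∂ⱼφ` (`Torus.integral_forceApproxSlice_mul_laplacian`: one
integration by parts, `∂ⱼΔ = Δ∂ⱼ`, Green, and `Δ(gⱼ ⋆ Δ⁻¹ρ) = gⱼ ⋆ ρ - (∫ρ)(∫gⱼ)`); for kernels of
equal mass `r_{ρ₁}[g] - r_{ρ₂}[g] = ∑ⱼ ∂ⱼ(gⱼ ⋆ (Δ⁻¹ρ₁ - Δ⁻¹ρ₂))`, so the gradient bound gives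
`∫⁻|r_{ρ₁}[g] - r_{ρ₂}[g]|^r ≤ n^{r-1}C^r ∑ⱼ ∫⁻ |gⱼ ⋆ ρ₁ - gⱼ ⋆ ρ₂|^r`
(`Torus.lintegral_rpow_forceApproxSlice_sub_le`) and `∫⁻|r_ρ[g]|^r ≤ K' ∑ⱼ ∫⁻|gⱼ|^r`
(`Torus.lintegral_rpow_forceApproxSlice_le`). With the canonical mollifiers `ρₙ`
(`Torus.presMollifier`) and Tonelli, `(rₙ)` is Cauchy in `L^p(α × T^d)` and has a limit `R`; the
weak equation passes to the limit along an a.e.-convergent subsequence of slices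
(`Torus.exists_forcePotential`).

## Mathlib / tree search

Mathlib (this pin): FTC `intervalIntegral.integral_eq_sub_of_hasDerivAt`,
`intervalIntegral.norm_integral_le_of_norm_le_const`, `AddCircle.coe_period`, completeness of `Lp`;
no inverse Laplacian / Riesz potentials on the torus. Tree (all reused, nothing redefined):
`FluidPDE/TorusPressurePoisson` (`HessianBound`, the generic `L^p`/limit tools, `presMollifier`,
`laplacian_convolution_invLaplacian(_sub)`, `integral_partialDeriv_mul_eq_neg_integral`),
`FunctionSpaces/TorusAxisAverage(Calculus)` (`axisAvg`, `proj_smul_single`,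
`integral_unitAddCircle_eq_intervalIntegral`, `measurePreserving_add_single_prod`,
`eLpNorm_comp_add_single`), `FunctionSpaces/MinkowskiIntegral` (`eLpNorm_integral_le_lintegral_eLpNorm`),
`TorusConvolution`, `TorusApproximateIdentity`, `TorusInverseLaplacian`, `TorusCalculusProofs`.

## References

* J. C. Robinson, J. L. Rodrigo, W. Sadowski, *The Three-Dimensional Navier–Stokes Equations:
  Classical Theory*, CUP 2016: §5.1, Lemma 5.1, (5.3)–(5.10) (book p. 88); §5.2, Prop. 5.3 and
  its proof (pp. 89–90); App. B, Thm. B.7 (pp. 385–386). [RobinsonRodrigoSadowskiCUP2016]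
* R. Temam, *Navier–Stokes Equations. Theory and Numerical Analysis*, 3rd ed. (1984), Ch. I
  Prop. 1.1–1.2, Ch. III §1.5 (recovery of the pressure of forced weak solutions). [Temam1984]
* L. C. Evans, *Partial Differential Equations*, 2nd ed. (2010), App. C.2 Thm. 2–3 (integration
  by parts, Green's identities). [Evans2010]
-/

noncomputable section

open MeasureTheory Set Filter Topology Function UnitAddTorus
open scoped ENNReal NNReal Convolution ContDiff

namespace Literature.Analysis.FluidPDE.Torus

open Literature.Analysis.FunctionSpaces Literature.Analysis.FunctionSpaces.Torus

variable {d : Type*} [Fintype d] [DecidableEq d]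


/-! ## The gradient bound from the Hessian bound: a Poincaré inequality along one axis -/

section GradientBound

variable {F : Type*} [NormedAddCommGroup F] [NormedSpace ℝ F] [CompleteSpace F]

/-- **Poincaré along a coordinate circle, pointwise**: for smooth `w` on `T^d`,
`‖∂ⱼw(x)‖ ≤ ∫ ‖∂ⱼ∂ⱼw(x + s eⱼ)‖ ds` (average over the `j`-th circle through `x`): the restriction
`γ(s) = ∂ⱼw(x + s eⱼ)` to the circle has zero mean (it is the derivative of the periodic
`s ↦ w(x + s eⱼ)`) and `γ(s) - γ(0) = ∫₀ˢ ∂ⱼ∂ⱼw(x + σ eⱼ) dσ`. [folklore] -/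
theorem norm_partialDeriv_le_axisAvg {w : UnitAddTorus d → F} (hw : IsSmooth w) (j : d) (x : UnitAddTorus d) :
    ‖Torus.partialDeriv j w x‖ ≤ axisAvg j (fun y => ‖Torus.partialDeriv j (Torus.partialDeriv j w) y‖) x := by
  set e : EuclideanSpace ℝ d := EuclideanSpace.single j (1 : ℝ) with he
  set g : UnitAddTorus d → F := Torus.partialDeriv j w with hg_def
  set h : UnitAddTorus d → F := Torus.partialDeriv j g with hh_def
  have hg : IsSmooth g := hw.partialDeriv j
  have hh : IsSmooth h := hg.partialDeriv j
  -- the curves along the `j`-th circle through `x`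
  set γ₀ : ℝ → F := fun s => w (x + proj (s • e)) with hγ₀
  set γ : ℝ → F := fun s => g (x + proj (s • e)) with hγ
  set η : ℝ → F := fun s => h (x + proj (s • e)) with hη
  have hdγ₀ : ∀ s, HasDerivAt γ₀ (γ s) s := fun s =>
    hasDerivAt_comp_add_proj_smul (hw.isContDiff (by simp)) x e s
  have hdγ : ∀ s, HasDerivAt γ (η s) s := fun s =>
    hasDerivAt_comp_add_proj_smul (hg.isContDiff (by simp)) x e s
  have hγc : Continuous γ := hg.continuous.comp (continuous_const.add (continuous_proj.comp (continuous_id.smul continuous_const)))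
  have hηc : Continuous η := hh.continuous.comp (continuous_const.add (continuous_proj.comp (continuous_id.smul continuous_const)))
  -- periodicity: `γ₀ 1 = γ₀ 0`
  have hper : γ₀ 1 = γ₀ 0 := by
    simp only [hγ₀, one_smul, zero_smul, proj_zero, add_zero]
    have h1 : proj e = (0 : UnitAddTorus d) := by
      have := proj_smul_single (d := d) (1 : ℝ) j
      rw [one_smul] at this
      rw [he, this]
      funext i
      by_cases hi : i = j
      · subst hi; simp [AddCircle.coe_period]
      · simp [hi]
    rw [h1, add_zero]
  -- zero mean of `γ` over a period
  have hmean : ∫ s in (0 : ℝ)..1, γ s = 0 := by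
    rw [intervalIntegral.integral_eq_sub_of_hasDerivAt (fun s _ => hdγ₀ s) (hγc.intervalIntegrable 0 1), hper,
      sub_self]
  -- the bound `M`
  set M : ℝ := ∫ σ in (0 : ℝ)..1, ‖η σ‖ with hM
  have hM0 : 0 ≤ M := intervalIntegral.integral_nonneg zero_le_one fun σ _ => norm_nonneg _
  have hincr : ∀ s ∈ Icc (0 : ℝ) 1, ‖γ s - γ 0‖ ≤ M := by
    intro s hs
    rw [← intervalIntegral.integral_eq_sub_of_hasDerivAt (fun σ _ => hdγ σ) (hηc.intervalIntegrable 0 s)]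
    calc ‖∫ σ in (0 : ℝ)..s, η σ‖ ≤ ∫ σ in (0 : ℝ)..s, ‖η σ‖ :=
          intervalIntegral.norm_integral_le_integral_norm hs.1
      _ ≤ M := intervalIntegral.integral_mono_interval le_rfl hs.1 hs.2
          (Eventually.of_forall fun σ => norm_nonneg _) (hηc.norm.intervalIntegrable 0 1)
  -- `γ 0 = ∫₀¹ (γ 0 - γ s) ds`
  have hrep : γ 0 = ∫ s in (0 : ℝ)..1, (γ 0 - γ s) := by
    rw [intervalIntegral.integral_sub intervalIntegrable_const (hγc.intervalIntegrable 0 1), hmean,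
      intervalIntegral.integral_const, sub_zero, sub_zero, one_smul]
  have hkey : ‖γ 0‖ ≤ M := by
    rw [hrep]
    have h := intervalIntegral.norm_integral_le_of_norm_le_const (a := (0 : ℝ)) (b := 1) (C := M)
      (f := fun s => γ 0 - γ s) fun s hs => by
        have hs' : s ∈ Ioc (0 : ℝ) 1 := by simpa [Set.uIoc_of_le (zero_le_one (α := ℝ))] using hs
        rw [norm_sub_rev]
        exact hincr s ⟨hs'.1.le, hs'.2⟩
    simpa using h
  -- identify both sides
  have hL : g x = γ 0 := by
    simp [hγ, proj_zero]
  have hR : axisAvg j (fun y => ‖h y‖) x = M := by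
    rw [axisAvg_apply, integral_unitAddCircle_eq_intervalIntegral]
    refine intervalIntegral.integral_congr fun σ _ => ?_
    simp only [hη, he, proj_smul_single]
  rw [hL, hR]
  exact hkey


omit [CompleteSpace F] in
/-- **Axis averaging does not increase `L^p` norms**, `1 ≤ p < ∞`: `‖axisAvg i W‖_p ≤ ‖W‖_p`
(Minkowski's integral inequality and translation invariance; the tree's `eLpNorm_axisAvg_le` is
the case `p = 2`). [folklore] -/
theorem eLpNorm_axisAvg_le_of_exponent (i : d) {W : UnitAddTorus d → F} (hW : AEStronglyMeasurable W volume)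
    {p : ℝ≥0∞} (hp1 : 1 ≤ p) (hpt : p ≠ ⊤) :
    eLpNorm (axisAvg i W) p volume ≤ eLpNorm W p volume := by
  set Φ : UnitAddTorus d → UnitAddCircle → F := fun x s => W (x + Pi.single i s) with hΦdef
  have hΦ : AEStronglyMeasurable (uncurry Φ)
      ((volume : Measure (UnitAddTorus d)).prod (volume : Measure UnitAddCircle)) :=
    hW.comp_measurePreserving (measurePreserving_add_single_prod i)
  have h : eLpNorm (fun x => ∫ s, Φ x s) p volume ≤ ∫⁻ s, eLpNorm (fun x => Φ x s) p volume :=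
    eLpNorm_integral_le_lintegral_eLpNorm hΦ hp1 hpt
  have hs : ∀ s : UnitAddCircle, eLpNorm (fun x => Φ x s) p volume = eLpNorm W p volume := fun s =>
    eLpNorm_comp_add_single i hW s p
  have hR : ∫⁻ s, eLpNorm (fun x => Φ x s) p (volume : Measure (UnitAddTorus d)) = eLpNorm W p volume := by
    rw [lintegral_congr fun s => hs s, lintegral_const, measure_univ, mul_one]
  rw [hR] at h
  exact h

/-- **`‖∂ⱼw‖_{L^p} ≤ ‖∂ⱼ∂ⱼw‖_{L^p}`** for smooth `w` on `T^d`, `1 ≤ p < ∞` (the pointwise Poincaré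
inequality along the `j`-th circle, `norm_partialDeriv_le_axisAvg`, and the `L^p` contractivity
of axis averages). [folklore] -/
theorem eLpNorm_partialDeriv_le_partialDeriv_partialDeriv {w : UnitAddTorus d → F} (hw : IsSmooth w)
    (j : d) {p : ℝ≥0∞} (hp1 : 1 ≤ p) (hpt : p ≠ ⊤) :
    eLpNorm (Torus.partialDeriv j w) p volume ≤ eLpNorm (Torus.partialDeriv j (Torus.partialDeriv j w)) p volume := by
  set h : UnitAddTorus d → F := Torus.partialDeriv j (Torus.partialDeriv j w) with hh_def
  have hh : IsSmooth h := (hw.partialDeriv j).partialDeriv j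
  have hN : AEStronglyMeasurable (fun y => ‖h y‖) volume := hh.continuous.norm.aestronglyMeasurable
  have h1 : eLpNorm (Torus.partialDeriv j w) p volume ≤ eLpNorm (axisAvg j fun y => ‖h y‖) p volume := by
    refine eLpNorm_mono fun x => ?_
    have hx := norm_partialDeriv_le_axisAvg hw j x
    refine hx.trans ?_
    exact Real.le_norm_self _
  have h2 : eLpNorm (axisAvg j fun y => ‖h y‖) p volume ≤ eLpNorm (fun y => ‖h y‖) p volume :=
    eLpNorm_axisAvg_le_of_exponent j hN hp1 hpt
  have h3 : eLpNorm (fun y => ‖h y‖) p volume = eLpNorm h p volume := eLpNorm_norm h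
  exact h1.trans (h2.trans h3.le)

/-- **The gradient bound from the Hessian bound**: if `‖∂ⱼ∂ₖw‖_p ≤ C‖Δw‖_p` for all smooth real `w`
(`Torus.HessianBound d p C`, the Calderón–Zygmund hypothesis of `FluidPDE/TorusPressurePoisson`;
Robinson–Rodrigo–Sadowski 2016, Thm. B.7), then also `‖∂ⱼw‖_p ≤ C‖Δw‖_p` for all smooth real `w`
and `1 ≤ p < ∞`, i.e. `∂ⱼΔ⁻¹` is bounded on `L^p(T^d)` with the same constant
(`‖∂ⱼw‖_p ≤ ‖∂ⱼ∂ⱼw‖_p`, `eLpNorm_partialDeriv_le_partialDeriv_partialDeriv`). [folklore] -/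
theorem eLpNorm_partialDeriv_le_of_hessianBound {p : ℝ≥0∞} {C : ℝ≥0} (hC : HessianBound d p C)
    (hp1 : 1 ≤ p) (hpt : p ≠ ⊤) {w : UnitAddTorus d → ℝ} (hw : IsSmooth w) (j : d) :
    eLpNorm (Torus.partialDeriv j w) p volume ≤ C * eLpNorm (Torus.laplacian w) p volume :=
  (eLpNorm_partialDeriv_le_partialDeriv_partialDeriv hw j hp1 hpt).trans (hC w hw j j)

end GradientBound

/-! ## The approximate potential of a vector slice -/

section Slice

/-! **Notation of this file (no definitions are introduced).** For a smooth kernel `ρ` the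
*force kernels* are `λⱼ[ρ] := ∂ⱼΔ⁻¹ρ = Torus.partialDeriv j (invLaplacian ρ)`, and the
*approximate potential* of a vector slice `g = (gⱼ)`, `gⱼ ∈ L¹(T^d)`, is
`r_ρ[g] := ∑ⱼ gⱼ ⋆ λⱼ[ρ] = ∑ⱼ ∂ⱼΔ⁻¹(gⱼ ⋆ ρ)`, written out as
`fun x => ∑ j, (g j ⋆ Torus.partialDeriv j (invLaplacian ρ)) x` in every statement (a convolution
with smooth kernels, so that joint measurability in a parameter is automatic). -/

variable {ρ : UnitAddTorus d → ℝ}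

/-- The force kernels `∂ⱼΔ⁻¹ρ` of a smooth mollifier are continuous. [folklore] -/
theorem continuous_partialDeriv_invLaplacian (hρ : IsSmooth ρ) (j : d) :
    Continuous (Torus.partialDeriv j (invLaplacian ρ)) :=
  ((isSmooth_invLaplacian hρ).partialDeriv j).continuous

/-- **Derivative form of the approximate potential**: for integrable data,
`r_ρ[g] = ∑ⱼ ∂ⱼ(gⱼ ⋆ Δ⁻¹ρ)` (derivatives of a mollification fall on the smooth kernel). [folklore] -/
theorem forceApproxSlice_eq_sum (hρ : IsSmooth ρ) {g : d → UnitAddTorus d → ℝ}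
    (hg : ∀ j, Integrable (g j) volume) (x : UnitAddTorus d) :
    (∑ j, (g j ⋆ Torus.partialDeriv j (invLaplacian ρ)) x) = ∑ j, Torus.partialDeriv j (g j ⋆ invLaplacian ρ) x := by
  refine Finset.sum_congr rfl fun j _ => ?_
  rw [partialDeriv_convolution (hg j) (isSmooth_invLaplacian hρ) j]

/-- The approximate potential of integrable data is continuous. [folklore] -/
theorem continuous_forceApproxSlice (hρ : IsSmooth ρ) {g : d → UnitAddTorus d → ℝ}
    (hg : ∀ j, Integrable (g j) volume) :
    Continuous (fun x => ∑ j, (g j ⋆ Torus.partialDeriv j (invLaplacian ρ)) x) :=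
  continuous_finsetSum _ fun j _ => continuous_convolution (hg j) (continuous_partialDeriv_invLaplacian hρ j)

/-- **Moving one derivative across the Laplacian**: `∫ (∂ⱼV) Δφ = -∫ (ΔV) ∂ⱼφ` for smooth real
`V`, `φ` on `T^d` (integration by parts, `∂ⱼΔ = Δ∂ⱼ`, Green's second identity). [folklore] -/
theorem integral_partialDeriv_mul_laplacian {V φ : UnitAddTorus d → ℝ} (hV : IsSmooth V) (hφ : IsSmooth φ) (j : d) :
    ∫ x, Torus.partialDeriv j V x * Torus.laplacian φ x = -∫ x, Torus.laplacian V x * Torus.partialDeriv j φ x := by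
  rw [integral_partialDeriv_mul_eq_neg_integral hV hφ.laplacian j]
  congr 1
  have e : (fun x => V x * Torus.partialDeriv j (Torus.laplacian φ) x) = fun x => V x * Torus.laplacian (Torus.partialDeriv j φ) x := by
    funext x; rw [partialDeriv_laplacian hφ j x]
  rw [e, integral_mul_laplacian_comm_holds hV (hφ.partialDeriv j)]

/-- **The approximate potential solves the mollified Poisson equation `Δr = div(g ⋆ ρ)` weakly**:
for integrable data `gⱼ`, a smooth mollifier `ρ` and every smooth test function `φ`,
`∫ r_ρ[g] Δφ = -∑ⱼ ∫ (gⱼ ⋆ ρ) ∂ⱼφ` (`d` nonempty): with `V = gⱼ ⋆ Δ⁻¹ρ`,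
`∫ (∂ⱼV) Δφ = -∫ (ΔV) ∂ⱼφ` and `ΔV = gⱼ ⋆ ρ - (∫ρ)(∫gⱼ)`, the constant integrating to zero
against `∂ⱼφ`. [folklore] -/
theorem integral_forceApproxSlice_mul_laplacian [Nonempty d] (hρ : IsSmooth ρ)
    {g : d → UnitAddTorus d → ℝ} (hg : ∀ j, Integrable (g j) volume)
    {φ : UnitAddTorus d → ℝ} (hφ : IsSmooth φ) :
    ∫ x, (∑ j, (g j ⋆ Torus.partialDeriv j (invLaplacian ρ)) x) * Torus.laplacian φ x =
      -∑ j, ∫ x, (g j ⋆ ρ) x * Torus.partialDeriv j φ x := by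
  have hΔρ : IsSmooth (invLaplacian ρ) := isSmooth_invLaplacian hρ
  have hV : ∀ j, IsSmooth (g j ⋆ invLaplacian ρ) := fun j => isSmooth_convolution (hg j) hΔρ
  have hpt : ∀ x, (∑ j, (g j ⋆ Torus.partialDeriv j (invLaplacian ρ)) x) * Torus.laplacian φ x =
      ∑ j, Torus.partialDeriv j (g j ⋆ invLaplacian ρ) x * Torus.laplacian φ x := by
    intro x
    rw [forceApproxSlice_eq_sum hρ hg, Finset.sum_mul]
  have hint : ∀ j, Integrable (fun x => Torus.partialDeriv j (g j ⋆ invLaplacian ρ) x * Torus.laplacian φ x) volume := by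
    intro j
    have hs : IsSmooth (fun x => Torus.partialDeriv j (g j ⋆ invLaplacian ρ) x * Torus.laplacian φ x) :=
      ((hV j).partialDeriv j).mul hφ.laplacian
    exact hs.integrable
  simp_rw [hpt]
  rw [integral_finsetSum _ fun j _ => hint j, ← Finset.sum_neg_distrib]
  refine Finset.sum_congr rfl fun j _ => ?_
  rw [integral_partialDeriv_mul_laplacian (hV j) hφ j]
  -- `ΔV = g ⋆ ρ - const`
  simp_rw [laplacian_convolution_invLaplacian hρ (hg j), sub_mul]
  have hψ : IsSmooth (Torus.partialDeriv j φ) := hφ.partialDeriv j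
  have hI1 : Integrable (fun x => (g j ⋆ ρ) x * Torus.partialDeriv j φ x) volume :=
    ((continuous_convolution (hg j) hρ.continuous).mul hψ.continuous).integrable_unitAddTorus
  have hI2 : Integrable (fun x => ((∫ y, ρ y) * ∫ y, g j y) * Torus.partialDeriv j φ x) volume :=
    (continuous_const.mul hψ.continuous).integrable_unitAddTorus
  rw [integral_sub hI1 hI2, integral_const_mul, integral_partialDeriv_eq_zero_holds hφ j, mul_zero, sub_zero]

end Slice

/-! ## `L^p` bounds for the approximate potential of a slice -/

section SliceBounds

variable {p : ℝ≥0∞} {C : ℝ≥0}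

omit [DecidableEq d] in
/-- `(∑ⱼ aⱼ)^r ≤ n^{r-1} ∑ⱼ aⱼ^r` for `r ≥ 1`, `n = #d` (convexity of `t ↦ t^r`). [folklore] -/
theorem rpow_sum_le (a : d → ℝ≥0∞) {r : ℝ} (hr : 1 ≤ r) :
    (∑ j, a j) ^ r ≤ (Fintype.card d : ℝ≥0∞) ^ (r - 1) * ∑ j, a j ^ r := by
  have h := ENNReal.rpow_sum_le_const_mul_sum_rpow Finset.univ a hr
  rwa [Finset.card_univ] at h

/-- The difference of two approximate potentials with kernels `ρ₁`, `ρ₂` is a sum of derivatives of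
one mollification: `r_{ρ₁}[g] - r_{ρ₂}[g] = ∑ⱼ ∂ⱼ(gⱼ ⋆ (Δ⁻¹ρ₁ - Δ⁻¹ρ₂))`. [folklore] -/
theorem forceApproxSlice_sub_eq {ρ₁ ρ₂ : UnitAddTorus d → ℝ} (hρ₁ : IsSmooth ρ₁) (hρ₂ : IsSmooth ρ₂)
    {g : d → UnitAddTorus d → ℝ} (hg : ∀ j, Integrable (g j) volume) (x : UnitAddTorus d) :
    (∑ j, (g j ⋆ Torus.partialDeriv j (invLaplacian ρ₁)) x) - (∑ j, (g j ⋆ Torus.partialDeriv j (invLaplacian ρ₂)) x) =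
      ∑ j, Torus.partialDeriv j (g j ⋆ fun y => invLaplacian ρ₁ y - invLaplacian ρ₂ y) x := by
  have h1 := isSmooth_invLaplacian (F := ℝ) hρ₁
  have h2 := isSmooth_invLaplacian (F := ℝ) hρ₂
  have hχ : IsSmooth (fun y => invLaplacian ρ₁ y - invLaplacian ρ₂ y) := h1.sub h2
  rw [forceApproxSlice_eq_sum hρ₁ hg, forceApproxSlice_eq_sum hρ₂ hg, ← Finset.sum_sub_distrib]
  refine Finset.sum_congr rfl fun j _ => ?_
  rw [partialDeriv_convolution (hg j) h1, partialDeriv_convolution (hg j) h2, partialDeriv_convolution (hg j) hχ,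
    ← convolution_sub_right_apply (hg j) (h1.partialDeriv j).continuous (h2.partialDeriv j).continuous]
  congr 1
  funext y
  -- `∂ⱼ(a - b) = ∂ⱼa - ∂ⱼb` for the `C¹` functions `a = Δ⁻¹ρ₁`, `b = Δ⁻¹ρ₂`
  have hsub : (fun y => invLaplacian ρ₁ y - invLaplacian ρ₂ y) = invLaplacian ρ₁ + fun y => -invLaplacian ρ₂ y := by
    funext y'; simp [sub_eq_add_neg]
  have h1' : IsContDiff 1 (invLaplacian ρ₁) := h1.isContDiff (by simp)
  have h2' : IsContDiff 1 (fun y => -invLaplacian ρ₂ y) := ContDiff.neg (h2.isContDiff (n := 1) (by simp))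
  rw [hsub, partialDeriv_add h1' h2', Pi.add_apply, partialDeriv_neg, ← sub_eq_add_neg]

/-- **The gradient-bound step**: for a smooth kernel `χ` and integrable data,
`∫⁻ |∑ⱼ ∂ⱼ(gⱼ ⋆ χ)|^r ≤ n^{r-1} C^r ∑ⱼ ∫⁻ |Δ(gⱼ ⋆ χ)|^r`, `r = p.toReal` (the gradient bound
`eLpNorm_partialDeriv_le_of_hessianBound` termwise, and convexity of `t ↦ t^r`). [folklore] -/
theorem lintegral_rpow_sum_partialDeriv_convolution_le (hp1 : 1 ≤ p) (hpt : p ≠ ⊤) (hC : HessianBound d p C)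
    {χ : UnitAddTorus d → ℝ} (hχ : IsSmooth χ) {g : d → UnitAddTorus d → ℝ}
    (hg : ∀ j, Integrable (g j) volume) :
    ∫⁻ x, ‖∑ j, Torus.partialDeriv j (g j ⋆ χ) x‖ₑ ^ p.toReal ≤
      (Fintype.card d : ℝ≥0∞) ^ (p.toReal - 1) * (C : ℝ≥0∞) ^ p.toReal *
        ∑ j, ∫⁻ x, ‖Torus.laplacian (g j ⋆ χ) x‖ₑ ^ p.toReal := by
  have hp0 : p ≠ 0 := (zero_lt_one.trans_le hp1).ne'
  have hr1 : 1 ≤ p.toReal := by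
    rw [← ENNReal.toReal_one]; exact (ENNReal.toReal_le_toReal ENNReal.one_ne_top hpt).2 hp1
  set H : d → UnitAddTorus d → ℝ := fun j => Torus.partialDeriv j (g j ⋆ χ) with hH_def
  have hW : ∀ j, IsSmooth (g j ⋆ χ) := fun j => isSmooth_convolution (hg j) hχ
  have hH : ∀ j, IsSmooth (H j) := fun j => (hW j).partialDeriv j
  have hpt' : ∀ x, ‖∑ j, H j x‖ₑ ^ p.toReal ≤
      (Fintype.card d : ℝ≥0∞) ^ (p.toReal - 1) * ∑ j, ‖H j x‖ₑ ^ p.toReal := by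
    intro x
    calc ‖∑ j, H j x‖ₑ ^ p.toReal ≤ (∑ j, ‖H j x‖ₑ) ^ p.toReal := by
          gcongr
          exact enorm_sum_le _ _
      _ ≤ _ := rpow_sum_le (fun j => ‖H j x‖ₑ) hr1
  have hGB : ∀ j, ∫⁻ x, ‖H j x‖ₑ ^ p.toReal ≤
      (C : ℝ≥0∞) ^ p.toReal * ∫⁻ x, ‖Torus.laplacian (g j ⋆ χ) x‖ₑ ^ p.toReal := fun j =>
    lintegral_rpow_le_of_eLpNorm_le hp0 hpt (eLpNorm_partialDeriv_le_of_hessianBound hC hp1 hpt (hW j) j)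
  calc ∫⁻ x, ‖∑ j, H j x‖ₑ ^ p.toReal
      ≤ ∫⁻ x, (Fintype.card d : ℝ≥0∞) ^ (p.toReal - 1) * ∑ j, ‖H j x‖ₑ ^ p.toReal := lintegral_mono hpt'
    _ = (Fintype.card d : ℝ≥0∞) ^ (p.toReal - 1) * ∑ j, ∫⁻ x, ‖H j x‖ₑ ^ p.toReal := by
        have hm : ∀ j, AEMeasurable (fun x => ‖H j x‖ₑ ^ p.toReal) volume := fun j =>
          ((hH j).continuous.measurable.enorm.pow_const _).aemeasurable
        rw [lintegral_const_mul' _ _ (ENNReal.rpow_ne_top_of_nonneg (by linarith) (by simp)),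
          lintegral_finsetSum' _ fun j _ => hm j]
    _ ≤ (Fintype.card d : ℝ≥0∞) ^ (p.toReal - 1) * ∑ j,
          ((C : ℝ≥0∞) ^ p.toReal * ∫⁻ x, ‖Torus.laplacian (g j ⋆ χ) x‖ₑ ^ p.toReal) := by
        gcongr with j _
        exact hGB j
    _ = _ := by
        simp only [Finset.mul_sum, mul_assoc]

/-- **Bound for the difference of two approximate potentials** (slice form): for smooth kernels
`ρ₁`, `ρ₂` of equal mass and integrable data,
`∫⁻ |r_{ρ₁}[g] - r_{ρ₂}[g]|^r ≤ n^{r-1} C^r ∑ⱼ ∫⁻ |gⱼ ⋆ ρ₁ - gⱼ ⋆ ρ₂|^r`, `r = p.toReal`. [folklore] -/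
theorem lintegral_rpow_forceApproxSlice_sub_le [Nonempty d] (hp1 : 1 ≤ p) (hpt : p ≠ ⊤) (hC : HessianBound d p C)
    {ρ₁ ρ₂ : UnitAddTorus d → ℝ} (hρ₁ : IsSmooth ρ₁) (hρ₂ : IsSmooth ρ₂) (hmass : ∫ y, ρ₁ y = ∫ y, ρ₂ y)
    {g : d → UnitAddTorus d → ℝ} (hg : ∀ j, Integrable (g j) volume) :
    ∫⁻ x, ‖(∑ j, (g j ⋆ Torus.partialDeriv j (invLaplacian ρ₁)) x) - (∑ j, (g j ⋆ Torus.partialDeriv j (invLaplacian ρ₂)) x)‖ₑ ^ p.toReal ≤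
      (Fintype.card d : ℝ≥0∞) ^ (p.toReal - 1) * (C : ℝ≥0∞) ^ p.toReal *
        ∑ j, ∫⁻ x, ‖(g j ⋆ ρ₁) x - (g j ⋆ ρ₂) x‖ₑ ^ p.toReal := by
  have hχ : IsSmooth (fun y => invLaplacian ρ₁ y - invLaplacian ρ₂ y) :=
    (isSmooth_invLaplacian hρ₁).sub (isSmooth_invLaplacian hρ₂)
  have h := lintegral_rpow_sum_partialDeriv_convolution_le hp1 hpt hC hχ hg
  simp_rw [laplacian_convolution_invLaplacian_sub hρ₁ hρ₂ hmass (hg _)] at h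
  refine le_trans (le_of_eq ?_) h
  refine lintegral_congr fun x => ?_
  rw [forceApproxSlice_sub_eq hρ₁ hρ₂ hg x]

/-- **Bound for the approximate potential** (slice form): for a smooth nonnegative kernel `ρ` of
unit mass and data `gⱼ ∈ L^p(T^d)`,
`∫⁻ |r_ρ[g]|^r ≤ n^{r-1} C^r 2^{r-1} · 2 ∑ⱼ ∫⁻ |gⱼ|^r`, `r = p.toReal`
(`Δ(gⱼ ⋆ Δ⁻¹ρ) = gⱼ ⋆ ρ - ∫gⱼ`, Young's inequality and Jensen). [folklore] -/
theorem lintegral_rpow_forceApproxSlice_le [Nonempty d] (hp1 : 1 ≤ p) (hpt : p ≠ ⊤) (hC : HessianBound d p C)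
    {ρ : UnitAddTorus d → ℝ} (hρ : IsSmooth ρ) (hρ0 : ∀ y, 0 ≤ ρ y) (hρ1 : ∫ y, ρ y = 1)
    {g : d → UnitAddTorus d → ℝ} (hg : ∀ j, MemLp (g j) p volume) :
    ∫⁻ x, ‖(∑ j, (g j ⋆ Torus.partialDeriv j (invLaplacian ρ)) x)‖ₑ ^ p.toReal ≤
      (Fintype.card d : ℝ≥0∞) ^ (p.toReal - 1) * (C : ℝ≥0∞) ^ p.toReal *
        ((2 : ℝ≥0∞) ^ (p.toReal - 1) * 2) * ∑ j, ∫⁻ x, ‖g j x‖ₑ ^ p.toReal := by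
  have hr1 : 1 ≤ p.toReal := by
    rw [← ENNReal.toReal_one]; exact (ENNReal.toReal_le_toReal ENNReal.one_ne_top hpt).2 hp1
  have hgi : ∀ j, Integrable (g j) volume := fun j => (hg j).integrable hp1
  have h := lintegral_rpow_sum_partialDeriv_convolution_le hp1 hpt hC (isSmooth_invLaplacian hρ) hgi
  simp_rw [laplacian_convolution_invLaplacian hρ (hgi _), hρ1, one_mul] at h
  have e0 : ∀ x, ‖(∑ j, (g j ⋆ Torus.partialDeriv j (invLaplacian ρ)) x)‖ₑ ^ p.toReal =
      ‖∑ j, Torus.partialDeriv j (g j ⋆ invLaplacian ρ) x‖ₑ ^ p.toReal := fun x => by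
    rw [forceApproxSlice_eq_sum hρ hgi x]
  simp_rw [e0]
  refine h.trans ?_
  have hterm : ∀ j, ∫⁻ x, ‖(g j ⋆ ρ) x - ∫ y, g j y‖ₑ ^ p.toReal ≤
      ((2 : ℝ≥0∞) ^ (p.toReal - 1) * 2) * ∫⁻ x, ‖g j x‖ₑ ^ p.toReal := by
    intro j
    refine (lintegral_rpow_sub_const_le _ _ hr1).trans ?_
    rw [mul_assoc, two_mul]
    exact mul_le_mul_right (add_le_add (lintegral_rpow_enorm_convolution_le (hg j).1 hρ.continuous hρ0 hρ1 hr1)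
      (enorm_integral_rpow_le_lintegral (hg j).1 hr1)) _
  calc _ ≤ (Fintype.card d : ℝ≥0∞) ^ (p.toReal - 1) * (C : ℝ≥0∞) ^ p.toReal *
        ∑ j, (((2 : ℝ≥0∞) ^ (p.toReal - 1) * 2) * ∫⁻ x, ‖g j x‖ₑ ^ p.toReal) := by
        gcongr with j _
        exact hterm j
    _ = _ := by
        simp only [Finset.mul_sum]
        refine Finset.sum_congr rfl fun j _ => ?_
        ring

end SliceBounds

/-! ## The approximate potentials of a time-dependent vector field -/

section SpaceTime

variable {α : Type*} [MeasurableSpace α] {μ : Measure α} [SFinite μ]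

/-! For a time-dependent vector field `Fv = (Fⱼ(a, x))` the approximate potentials are taken
slice-wise, `r_ρ[Fv](a) = r_ρ[Fv(a)] = ∑ⱼ Fⱼ(a) ⋆ λⱼ[ρ]`, i.e.
`fun a x => ∑ j, (Fv j a ⋆ Torus.partialDeriv j (invLaplacian ρ)) x`. -/

variable {p : ℝ≥0∞} {C : ℝ≥0}

/-- **The approximate potentials are jointly measurable** (parametrised convolutions with
continuous kernels, `Torus.aestronglyMeasurable_uncurry_convolution`). [folklore] -/
theorem aestronglyMeasurable_uncurry_forceApprox {ρ : UnitAddTorus d → ℝ} (hρ : IsSmooth ρ)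
    {Fv : d → α → UnitAddTorus d → ℝ}
    (hFm : ∀ j, AEStronglyMeasurable (uncurry (Fv j)) (μ.prod volume)) :
    AEStronglyMeasurable (uncurry fun a x => ∑ j, (Fv j a ⋆ Torus.partialDeriv j (invLaplacian ρ)) x)
      (μ.prod volume) := by
  have h : (uncurry fun a x => ∑ j, (Fv j a ⋆ Torus.partialDeriv j (invLaplacian ρ)) x) =
      fun z => ∑ j, (Fv j z.1 ⋆ Torus.partialDeriv j (invLaplacian ρ)) z.2 := by
    funext z; rfl
  rw [h]
  refine Finset.aestronglyMeasurable_fun_sum _ fun j _ => ?_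
  exact aestronglyMeasurable_uncurry_convolution (ContinuousLinearMap.lsmul ℝ ℝ) (hFm j)
    (continuous_partialDeriv_invLaplacian hρ j)

/-! **The constant of the potential bounds** is `K' = n^{r-1} C^r 2^{r-1} · 2`, `r = p.toReal`,
`n = #d`, `C` the Calderón–Zygmund constant of `HessianBound d p C`, written out in every
statement. -/

omit [DecidableEq d] in
/-- The constant of the potential bounds is finite (`1 ≤ p`). [folklore] -/
theorem forceConst_lt_top (hp1 : 1 ≤ p) (hpt : p ≠ ⊤) :
    (Fintype.card d : ℝ≥0∞) ^ (p.toReal - 1) * (C : ℝ≥0∞) ^ p.toReal * ((2 : ℝ≥0∞) ^ (p.toReal - 1) * 2) < ⊤ := by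
  have hr1 : 1 ≤ p.toReal := by
    rw [← ENNReal.toReal_one]; exact (ENNReal.toReal_le_toReal ENNReal.one_ne_top hpt).2 hp1
  refine ENNReal.mul_lt_top (ENNReal.mul_lt_top ?_ ?_) (ENNReal.mul_lt_top ?_ ENNReal.ofNat_lt_top)
  · exact ENNReal.rpow_lt_top_of_nonneg (by linarith) (by simp)
  · exact ENNReal.rpow_lt_top_of_nonneg (by linarith) ENNReal.coe_ne_top
  · exact ENNReal.rpow_lt_top_of_nonneg (by linarith) ENNReal.ofNat_ne_top

omit [DecidableEq d] [SFinite μ] in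
/-- Slices of an `L^p` vector field on `α × T^d` are a.e. in `L^p(T^d)`, all components at once. [folklore] -/
theorem ae_forall_memLp_slice_vec (hp0 : p ≠ 0) (hpt : p ≠ ⊤) {Fv : d → α → UnitAddTorus d → ℝ}
    (hFm : ∀ j, AEStronglyMeasurable (uncurry (Fv j)) (μ.prod volume))
    (hFf : ∀ j, ∫⁻ z, ‖Fv j z.1 z.2‖ₑ ^ p.toReal ∂(μ.prod volume) < ⊤) :
    ∀ᵐ a ∂μ, ∀ j, MemLp (Fv j a) p volume :=
  ae_all_iff.2 fun j => ae_memLp_slice_of_lintegral hp0 hpt (hFm j) (hFf j)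

/-- **`L^p` bound for the difference of two approximate potentials on the product space**
(Tonelli over the slice bound `lintegral_rpow_forceApproxSlice_sub_le`). [folklore] -/
theorem lintegral_prod_rpow_forceApprox_sub_le [Nonempty d] (hp1 : 1 ≤ p) (hpt : p ≠ ⊤)
    (hC : HessianBound d p C) {ρ₁ ρ₂ : UnitAddTorus d → ℝ} (hρ₁ : IsSmooth ρ₁) (hρ₂ : IsSmooth ρ₂)
    (hmass : ∫ y, ρ₁ y = ∫ y, ρ₂ y) {Fv : d → α → UnitAddTorus d → ℝ}
    (hFm : ∀ j, AEStronglyMeasurable (uncurry (Fv j)) (μ.prod volume))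
    (hFf : ∀ j, ∫⁻ z, ‖Fv j z.1 z.2‖ₑ ^ p.toReal ∂(μ.prod volume) < ⊤) :
    ∫⁻ z, ‖(∑ j, ((Fv · z.1) j ⋆ Torus.partialDeriv j (invLaplacian ρ₁)) z.2) -
        (∑ j, ((Fv · z.1) j ⋆ Torus.partialDeriv j (invLaplacian ρ₂)) z.2)‖ₑ ^ p.toReal ∂(μ.prod volume) ≤
      (Fintype.card d : ℝ≥0∞) ^ (p.toReal - 1) * (C : ℝ≥0∞) ^ p.toReal *
        ∑ j, ∫⁻ z, ‖(Fv j z.1 ⋆ ρ₁) z.2 - (Fv j z.1 ⋆ ρ₂) z.2‖ₑ ^ p.toReal ∂(μ.prod volume) := by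
  have hp0 : p ≠ 0 := (zero_lt_one.trans_le hp1).ne'
  set A : ℝ≥0∞ := (Fintype.card d : ℝ≥0∞) ^ (p.toReal - 1) * (C : ℝ≥0∞) ^ p.toReal with hA
  -- measurability
  have hPm : AEStronglyMeasurable (fun z : α × UnitAddTorus d =>
      (∑ j, ((Fv · z.1) j ⋆ Torus.partialDeriv j (invLaplacian ρ₁)) z.2) -
        (∑ j, ((Fv · z.1) j ⋆ Torus.partialDeriv j (invLaplacian ρ₂)) z.2)) (μ.prod volume) :=
    (aestronglyMeasurable_uncurry_forceApprox hρ₁ hFm).sub (aestronglyMeasurable_uncurry_forceApprox hρ₂ hFm)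
  have hDm : ∀ j, AEStronglyMeasurable (fun z : α × UnitAddTorus d =>
      (Fv j z.1 ⋆ ρ₁) z.2 - (Fv j z.1 ⋆ ρ₂) z.2) (μ.prod volume) := fun j =>
    (aestronglyMeasurable_uncurry_convolution_slice (hFm j) hρ₁.continuous).sub
      (aestronglyMeasurable_uncurry_convolution_slice (hFm j) hρ₂.continuous)
  -- Tonelli on both sides
  rw [lintegral_prod _ (hPm.enorm.pow_const _)]
  have eR : ∀ j, ∫⁻ z, ‖(Fv j z.1 ⋆ ρ₁) z.2 - (Fv j z.1 ⋆ ρ₂) z.2‖ₑ ^ p.toReal ∂(μ.prod volume) =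
      ∫⁻ a, ∫⁻ x, ‖(Fv j a ⋆ ρ₁) x - (Fv j a ⋆ ρ₂) x‖ₑ ^ p.toReal ∂volume ∂μ := fun j =>
    lintegral_prod _ ((hDm j).enorm.pow_const _)
  simp_rw [eR]
  -- the slice bound, a.e. in `a`
  have hslice : ∀ᵐ a ∂μ, ∫⁻ x, ‖(∑ j, ((Fv · a) j ⋆ Torus.partialDeriv j (invLaplacian ρ₁)) x) -
        (∑ j, ((Fv · a) j ⋆ Torus.partialDeriv j (invLaplacian ρ₂)) x)‖ₑ ^ p.toReal ∂volume ≤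
      A * ∑ j, ∫⁻ x, ‖(Fv j a ⋆ ρ₁) x - (Fv j a ⋆ ρ₂) x‖ₑ ^ p.toReal ∂volume := by
    filter_upwards [ae_forall_memLp_slice_vec hp0 hpt hFm hFf] with a ha
    exact lintegral_rpow_forceApproxSlice_sub_le hp1 hpt hC hρ₁ hρ₂ hmass fun j => (ha j).integrable hp1
  refine (lintegral_mono_ae hslice).trans (le_of_eq ?_)
  have hm : ∀ j, AEMeasurable (fun a => ∫⁻ x, ‖(Fv j a ⋆ ρ₁) x - (Fv j a ⋆ ρ₂) x‖ₑ ^ p.toReal ∂volume) μ :=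
    fun j => ((hDm j).enorm.pow_const _).lintegral_prod_right'
  rw [lintegral_const_mul'' _ (Finset.aemeasurable_fun_sum _ fun j _ => hm j)]
  congr 1
  rw [lintegral_finsetSum' _ fun j _ => hm j]

/-- **`L^p` bound for the approximate potentials on the product space**:
`∫⁻ |r_ρ[Fv]|^r ≤ K' ∑ⱼ ∫⁻ |Fⱼ|^r` for a smooth nonnegative unit-mass kernel (Tonelli over
`lintegral_rpow_forceApproxSlice_le`). [folklore] -/
theorem lintegral_prod_rpow_forceApprox_le [Nonempty d] (hp1 : 1 ≤ p) (hpt : p ≠ ⊤)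
    (hC : HessianBound d p C) {ρ : UnitAddTorus d → ℝ} (hρ : IsSmooth ρ) (hρ0 : ∀ y, 0 ≤ ρ y)
    (hρ1 : ∫ y, ρ y = 1) {Fv : d → α → UnitAddTorus d → ℝ}
    (hFm : ∀ j, AEStronglyMeasurable (uncurry (Fv j)) (μ.prod volume))
    (hFf : ∀ j, ∫⁻ z, ‖Fv j z.1 z.2‖ₑ ^ p.toReal ∂(μ.prod volume) < ⊤) :
    ∫⁻ z, ‖(∑ j, ((Fv · z.1) j ⋆ Torus.partialDeriv j (invLaplacian ρ)) z.2)‖ₑ ^ p.toReal ∂(μ.prod volume) ≤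
      (Fintype.card d : ℝ≥0∞) ^ (p.toReal - 1) * (C : ℝ≥0∞) ^ p.toReal * ((2 : ℝ≥0∞) ^ (p.toReal - 1) * 2) *
        ∑ j, ∫⁻ z, ‖Fv j z.1 z.2‖ₑ ^ p.toReal ∂(μ.prod volume) := by
  have hp0 : p ≠ 0 := (zero_lt_one.trans_le hp1).ne'
  have hPm : AEStronglyMeasurable (fun z : α × UnitAddTorus d => (∑ j, ((Fv · z.1) j ⋆ Torus.partialDeriv j (invLaplacian ρ)) z.2)) (μ.prod volume) :=
    aestronglyMeasurable_uncurry_forceApprox hρ hFm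
  rw [lintegral_prod _ (hPm.enorm.pow_const _)]
  have eR : ∀ j, ∫⁻ z, ‖Fv j z.1 z.2‖ₑ ^ p.toReal ∂(μ.prod volume) =
      ∫⁻ a, ∫⁻ x, ‖Fv j a x‖ₑ ^ p.toReal ∂volume ∂μ := fun j =>
    lintegral_prod _ ((hFm j).enorm.pow_const _)
  simp_rw [eR]
  have hslice : ∀ᵐ a ∂μ, ∫⁻ x, ‖(∑ j, ((Fv · a) j ⋆ Torus.partialDeriv j (invLaplacian ρ)) x)‖ₑ ^ p.toReal ∂volume ≤
      (Fintype.card d : ℝ≥0∞) ^ (p.toReal - 1) * (C : ℝ≥0∞) ^ p.toReal * ((2 : ℝ≥0∞) ^ (p.toReal - 1) * 2) *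
        ∑ j, ∫⁻ x, ‖Fv j a x‖ₑ ^ p.toReal ∂volume := by
    filter_upwards [ae_forall_memLp_slice_vec hp0 hpt hFm hFf] with a ha
    exact lintegral_rpow_forceApproxSlice_le hp1 hpt hC hρ hρ0 hρ1 ha
  refine (lintegral_mono_ae hslice).trans (le_of_eq ?_)
  have hm : ∀ j, AEMeasurable (fun a => ∫⁻ x, ‖Fv j a x‖ₑ ^ p.toReal ∂volume) μ :=
    fun j => ((hFm j).enorm.pow_const _).lintegral_prod_right'
  rw [lintegral_const_mul'' _ (Finset.aemeasurable_fun_sum _ fun j _ => hm j)]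
  congr 1
  rw [lintegral_finsetSum' _ fun j _ => hm j]

end SpaceTime

/-! ## The potential: existence of the `L^p` limit and the weak Poisson equation `ΔR = div F` -/

section Potential

variable {α : Type*} [MeasurableSpace α] {μ : Measure α} [SFinite μ] {p : ℝ≥0∞} {C : ℝ≥0}

/-- **The potential `Δ⁻¹ div F` of an `L^p` vector field on `α × T^d`** (`1 < p < ∞` through the
Calderón–Zygmund hypothesis `HessianBound d p C`, via the gradient bound): the approximate
potentials `rₙ = r_{ρₙ}[Fv]` converge in `L^p(α × T^d)` to a jointly measurable `R` with
`∫⁻ |R|^r ≤ K' ∑ⱼ ∫⁻ |Fⱼ|^r`, and for a.e. parameter `a` the slice `R(a)` is a very weak solution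
of the Poisson equation `ΔR(a) = div F(a)`:
`∫ R(a) Δφ = -∑ⱼ ∫ Fⱼ(a) ∂ⱼφ` for every smooth `φ` (the second half of the pressure
`p = (−Δ)⁻¹ div div (u ⊗ u) − (−Δ)⁻¹ div f` of a forced weak solution; Temam 1984, Ch. III §1.5
with Ch. I Prop. 1.1–1.2; Robinson–Rodrigo–Sadowski 2016, Lemma 5.1 for the tensor half). The
`L^p` limit exists because `(rₙ)` is Cauchy (`lintegral_prod_rpow_forceApprox_sub_le` and the `L^p`
approximate identity on the product); the weak equation passes to the limit slice-wise along an
a.e.-convergent subsequence. [folklore] -/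
theorem exists_forcePotential [Nonempty d] (hp1 : 1 ≤ p) (hpt : p ≠ ⊤) (hC : HessianBound d p C)
    {Fv : d → α → UnitAddTorus d → ℝ}
    (hFm : ∀ j, AEStronglyMeasurable (uncurry (Fv j)) (μ.prod volume))
    (hFf : ∀ j, ∫⁻ z, ‖Fv j z.1 z.2‖ₑ ^ p.toReal ∂(μ.prod volume) < ⊤) :
    ∃ R : α → UnitAddTorus d → ℝ,
      AEStronglyMeasurable (uncurry R) (μ.prod volume) ∧
      ∫⁻ z, ‖R z.1 z.2‖ₑ ^ p.toReal ∂(μ.prod volume) ≤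
        (Fintype.card d : ℝ≥0∞) ^ (p.toReal - 1) * (C : ℝ≥0∞) ^ p.toReal * ((2 : ℝ≥0∞) ^ (p.toReal - 1) * 2) *
          ∑ j, ∫⁻ z, ‖Fv j z.1 z.2‖ₑ ^ p.toReal ∂(μ.prod volume) ∧
      ∀ᵐ a ∂μ, ∀ φ : UnitAddTorus d → ℝ, IsSmooth φ →
        ∫ x, R a x * Torus.laplacian φ x = -∑ j, ∫ x, Fv j a x * Torus.partialDeriv j φ x := by
  have hp0 : p ≠ 0 := (zero_lt_one.trans_le hp1).ne'
  have hr : 0 < p.toReal := ENNReal.toReal_pos hp0 hpt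
  set K : ℝ≥0∞ := (Fintype.card d : ℝ≥0∞) ^ (p.toReal - 1) * (C : ℝ≥0∞) ^ p.toReal * ((2 : ℝ≥0∞) ^ (p.toReal - 1) * 2) with hK
  have hKt : K < ⊤ := forceConst_lt_top hp1 hpt
  set S : ℝ≥0∞ := ∑ j, ∫⁻ z, ‖Fv j z.1 z.2‖ₑ ^ p.toReal ∂(μ.prod volume) with hS
  have hSt : S < ⊤ := ENNReal.sum_lt_top.2 fun j _ => hFf j
  -- the approximants as functions on the product
  set f : ℕ → α × UnitAddTorus d → ℝ := fun n z =>
    ∑ j, (Fv j z.1 ⋆ Torus.partialDeriv j (invLaplacian (presMollifier n))) z.2 with hf_def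
  have hfm : ∀ n, AEStronglyMeasurable (f n) (μ.prod volume) := fun n =>
    aestronglyMeasurable_uncurry_forceApprox (isSmooth_presMollifier n) hFm
  have hfb : ∀ n, ∫⁻ z, ‖f n z‖ₑ ^ p.toReal ∂(μ.prod volume) ≤ K * S := fun n =>
    lintegral_prod_rpow_forceApprox_le hp1 hpt hC (isSmooth_presMollifier n) (presMollifier_nonneg n)
      (integral_presMollifier n) hFm hFf
  have hfp : ∀ n, MemLp (f n) p (μ.prod volume) := fun n =>
    memLp_of_lintegral_prod_lt_top hp0 hpt (hfm n) ((hfb n).trans_lt (ENNReal.mul_lt_top hKt hSt))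
  -- Cauchy in `L^p`
  have hCauchy : Tendsto (fun nm : ℕ × ℕ => eLpNorm (f nm.1 - f nm.2) p (μ.prod volume)) atTop (𝓝 0) := by
    refine tendsto_eLpNorm_of_tendsto_lintegral_rpow hp0 hpt ?_
    set D : d → ℕ × ℕ → ℝ≥0∞ := fun j nm => ∫⁻ z, ‖(Fv j z.1 ⋆ presMollifier nm.1) z.2 -
      (Fv j z.1 ⋆ presMollifier nm.2) z.2‖ₑ ^ p.toReal ∂(μ.prod volume) with hD
    have hD0 : ∀ j, Tendsto (D j) atTop (𝓝 0) := fun j =>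
      tendsto_lintegral_prod_convolution_sub_convolution hp1 hpt (hFm j) (hFf j)
    set A : ℝ≥0∞ := (Fintype.card d : ℝ≥0∞) ^ (p.toReal - 1) * (C : ℝ≥0∞) ^ p.toReal with hA
    have hAt : A ≠ ⊤ := by
      have hr1 : 1 ≤ p.toReal := by
        rw [← ENNReal.toReal_one]; exact (ENNReal.toReal_le_toReal ENNReal.one_ne_top hpt).2 hp1
      exact (ENNReal.mul_lt_top (ENNReal.rpow_lt_top_of_nonneg (by linarith) (by simp))
        (ENNReal.rpow_lt_top_of_nonneg (by linarith) ENNReal.coe_ne_top)).ne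
    have hbound : ∀ nm : ℕ × ℕ, ∫⁻ z, ‖(f nm.1 - f nm.2) z‖ₑ ^ p.toReal ∂(μ.prod volume) ≤
        A * ∑ j, D j nm := fun nm =>
      lintegral_prod_rpow_forceApprox_sub_le hp1 hpt hC (isSmooth_presMollifier nm.1)
        (isSmooth_presMollifier nm.2) (by rw [integral_presMollifier, integral_presMollifier]) hFm hFf
    have hlim : Tendsto (fun nm : ℕ × ℕ => A * ∑ j, D j nm) atTop (𝓝 0) := by
      have hs : Tendsto (fun nm : ℕ × ℕ => ∑ j, D j nm) atTop (𝓝 0) := by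
        have := tendsto_finsetSum (Finset.univ : Finset d) (a := fun _ => (0 : ℝ≥0∞)) (f := fun j nm => D j nm)
          (x := (atTop : Filter (ℕ × ℕ))) fun j _ => hD0 j
        simpa using this
      simpa using ENNReal.Tendsto.const_mul hs (Or.inr hAt)
    exact tendsto_of_tendsto_of_tendsto_of_le_of_le tendsto_const_nhds hlim (fun _ => zero_le) hbound
  -- the limit
  obtain ⟨Ru, hRu, hRlim⟩ := exists_memLp_tendsto_of_tendsto_eLpNorm_sub hp1 hfp hCauchy
  have hRlim' : Tendsto (fun n => ∫⁻ z, ‖f n z - Ru z‖ₑ ^ p.toReal ∂(μ.prod volume)) atTop (𝓝 0) :=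
    tendsto_lintegral_rpow_of_tendsto_eLpNorm hp0 hpt hRlim
  refine ⟨fun a x => Ru (a, x), hRu.1, ?_, ?_⟩
  · -- the bound passes to the limit
    set B : ℝ≥0∞ := (K * S) ^ (1 / p.toReal) with hB
    have hfn : ∀ n, eLpNorm (f n) p (μ.prod volume) ≤ B := fun n => by
      rw [eLpNorm_eq_lintegral_rpow_enorm_toReal hp0 hpt, hB]
      exact ENNReal.rpow_le_rpow (hfb n) (by positivity)
    have hle : ∀ n, eLpNorm Ru p (μ.prod volume) ≤ eLpNorm (f n - Ru) p (μ.prod volume) + B := by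
      intro n
      have e : Ru = (Ru - f n) + f n := by funext z; simp
      calc eLpNorm Ru p (μ.prod volume) = eLpNorm ((Ru - f n) + f n) p (μ.prod volume) := by rw [← e]
        _ ≤ eLpNorm (Ru - f n) p (μ.prod volume) + eLpNorm (f n) p (μ.prod volume) :=
            eLpNorm_add_le (hRu.1.sub (hfm n)) (hfm n) hp1
        _ ≤ _ := by rw [eLpNorm_sub_comm]; exact add_le_add_right (hfn n) _
    have hlimB : Tendsto (fun n => eLpNorm (f n - Ru) p (μ.prod volume) + B) atTop (𝓝 (0 + B)) :=
      hRlim.add tendsto_const_nhds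
    rw [zero_add] at hlimB
    have hP : eLpNorm Ru p (μ.prod volume) ≤ B := ge_of_tendsto' hlimB hle
    have h2 := ENNReal.rpow_le_rpow hP hr.le
    rw [eLpNorm_eq_lintegral_rpow_enorm_toReal hp0 hpt, one_div, ENNReal.rpow_inv_rpow hr.ne', hB, one_div,
      ENNReal.rpow_inv_rpow hr.ne'] at h2
    exact h2
  · -- the weak Poisson equation, slice-wise a.e.
    set g : ℕ → α → ℝ≥0∞ := fun n a => ∫⁻ x, ‖f n (a, x) - Ru (a, x)‖ₑ ^ p.toReal ∂volume with hg
    have hgm : ∀ n, AEMeasurable (g n) μ := fun n =>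
      (((hfm n).sub hRu.1).enorm.pow_const _).lintegral_prod_right'
    have hg0 : Tendsto (fun n => ∫⁻ a, g n a ∂μ) atTop (𝓝 0) := by
      refine (tendsto_congr fun n => ?_).1 hRlim'
      exact lintegral_prod _ (((hfm n).sub hRu.1).enorm.pow_const _)
    obtain ⟨ns, hns, hae⟩ := exists_strictMono_tendsto_ae_of_tendsto_lintegral hgm hg0
    have hRuf : ∫⁻ z, ‖Ru z‖ₑ ^ p.toReal ∂(μ.prod volume) < ⊤ :=
      lintegral_rpow_enorm_lt_top_of_eLpNorm_lt_top hp0 hpt hRu.2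
    have hRslice : ∀ᵐ a ∂μ, MemLp (fun x => Ru (a, x)) p volume :=
      ae_memLp_slice_of_lintegral hp0 hpt (Θ := fun a x => Ru (a, x)) hRu.1 hRuf
    filter_upwards [hae, ae_forall_memLp_slice_vec hp0 hpt hFm hFf, hRslice] with a ha hFa hRa φ hφ
    have hFi : ∀ j, Integrable (Fv j a) volume := fun j => (hFa j).integrable hp1
    -- the identity for the approximants
    have hid : ∀ k, ∫ x, f (ns k) (a, x) * Torus.laplacian φ x =
        -∑ j, ∫ x, (Fv j a ⋆ presMollifier (ns k)) x * Torus.partialDeriv j φ x := fun k =>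
      integral_forceApproxSlice_mul_laplacian (isSmooth_presMollifier (ns k)) hFi hφ
    -- left-hand sides converge
    have hL : Tendsto (fun k => ∫ x, f (ns k) (a, x) * Torus.laplacian φ x) atTop (𝓝 (∫ x, Ru (a, x) * Torus.laplacian φ x)) := by
      refine tendsto_integral_mul_of_tendsto_eLpNorm hp1 (g := fun k x => f (ns k) (a, x)) (fun k => ?_) hRa ?_
        hφ.laplacian.continuous
      · exact (continuous_forceApproxSlice (isSmooth_presMollifier (ns k)) hFi).memLp_of_hasCompactSupport
          (HasCompactSupport.of_compactSpace _)
      · exact tendsto_eLpNorm_of_tendsto_lintegral_rpow hp0 hpt ha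
    -- right-hand sides converge
    have hR : Tendsto (fun k => -∑ j, ∫ x, (Fv j a ⋆ presMollifier (ns k)) x * Torus.partialDeriv j φ x)
        atTop (𝓝 (-∑ j, ∫ x, Fv j a x * Torus.partialDeriv j φ x)) := by
      refine Tendsto.neg (tendsto_finsetSum _ fun j _ => ?_)
      have hconv : Tendsto (fun k => eLpNorm (fun x => (Fv j a ⋆ presMollifier (ns k)) x - Fv j a x) p volume)
          atTop (𝓝 0) := by
        have h := tendsto_eLpNorm_convolution_sub_self_of_eventually eventually_presMollifier
          (fun δ hδ => eventually_support_presMollifier_subset hδ) hp1 hpt (hFa j)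
        exact h.comp hns.tendsto_atTop
      refine tendsto_integral_mul_of_tendsto_eLpNorm hp1 (g := fun k x => (Fv j a ⋆ presMollifier (ns k)) x)
        (fun k => ?_) (hFa j) hconv (hφ.partialDeriv j).continuous
      exact (continuous_convolution (hFi j) (isSmooth_presMollifier (ns k)).continuous).memLp_of_hasCompactSupport
        (HasCompactSupport.of_compactSpace _)
    have hL' : Tendsto (fun k => ∫ x, f (ns k) (a, x) * Torus.laplacian φ x) atTop
        (𝓝 (-∑ j, ∫ x, Fv j a x * Torus.partialDeriv j φ x)) :=
      (tendsto_congr hid).2 hR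
    exact tendsto_nhds_unique hL hL'

end Potential


end Literature.Analysis.FluidPDE.Torus
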